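import Summits.AtomisticToContinuum.FouriersLaw.Theorems.BondHeatUncertaintyLightConeBondHeatAutocorrelation

/-!
# The equilibrium bond-current autocorrelation `C_N(b,s)` and bond-heat variance `V_N(b,t)` at every bond

Support file for item `stmt-AtomisticToContinuum-9123` (`BondHeatUncertainty.LightConeBondHeat`): the objects of
the window laws (S) `SubdiffusiveBondHeat` / (S_lc) `LightConeBondHeat`,
`C_N(b,s) = ∫ j_b(z) (P_s j_b)(z) dμ_T(z)` and `V_N(b,t) = 2∫₀ᵗ (t−s) C_N(b,s) ds`, are honest at EVERY bond `b` of
the pinned anharmonic chain `pinnedChain ω₂ lam β γ` (`ω₂ > 0`, `lam ≥ 0`, `β, γ > 0`, `N ≥ 1`, `T > 0`):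

* `pinnedChain_abs_bondCurrent_le_exp` — the currents are of exponential class, `|j_b| ≤ M_N(ϑ) e^{ϑH}`, every
  `ϑ > 0`;
* `pinnedChain_bondCorr_abs_le` — `|C_N(b,s)| ≤ ⟨j_b²⟩_T := ∫ j_b² dμ_T` (finite: `pinnedChain_integrable_sq_bondCurrent`);
* `pinnedChain_measurable_bondCorr`, `pinnedChain_continuous_bondCorr` — `C_N(b,·)` is measurable and continuous;
* `pinnedChain_bondCorr_exp_decay` — `|C_N(b,s)| ≤ C' e^{−cs}` at fixed `N` (`μ_T(j_b) = 0`, CEHR (2.5));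
* `pinnedChain_abs_bondHeatVar_le_sq`, `pinnedChain_bondHeatVar_dite_le_sq` — `V_N(b,t) ≤ 2⟨j_b²⟩_T t²` (`t ≥ 0`),
  also in the `dite` spelling of the route items; `pinnedChain_bondHeatVar_le_sqrt_of_le` — hence on every BOUNDED
  window `1 ≤ t ≤ t₀` the law `V_N(b,t) ≤ A√t` holds with `A = 2⟨j_b²⟩_T t₀√t₀`.

So the short-time end of (S_lc) is a size bound; its content is the N-uniform `√t` law on `[1, aN]`, i.e. the
dynamical cancellation `∫₀ᵗ C_N(b,·) = O(t^{-1/2})` for a bulk bond (the single-bond current autocorrelation of a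
diffusive chain integrates to zero), which this file does not address.
-/

noncomputable section

open MeasureTheory ProbabilityTheory Filter Topology Set
open scoped NNReal ENNReal

namespace Summit.AtomisticToContinuum.FouriersLaw.Theorems.LightConeBondHeat

open Literature.MathematicalPhysics.KineticTheory.HeatConduction
open Literature.MathematicalPhysics.KineticTheory Literature.Probability.Process OscillatorChain
open Summit.AtomisticToContinuum.FouriersLaw.Theorems.SubdiffusiveBondHeat

variable {N : ℕ}

/-! ### The bond currents are observables of exponential class -/

/-- **`|j_i| ≤ M_N(ϑ) e^{ϑH}`** for every `ϑ > 0`, with `M_N(ϑ) = N (3+β)/2 · 2e^{ϑ}/ϑ²`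
(`|j_i| ≤ N(3+β)/2 (1+H)²` and `(1+H)² ≤ 2e^{ϑ}ϑ⁻² e^{ϑH}`). [folklore] -/
theorem pinnedChain_abs_bondCurrent_le_exp {ω₂ lam β : ℝ} (hω : 0 ≤ ω₂) (hl : 0 ≤ lam) (hβ : 0 ≤ β) (γ : ℝ)
    (N : ℕ) {ϑ : ℝ} (hϑ : 0 < ϑ) (i : Fin N) (y : PhaseSpace N) :
    |(pinnedChain ω₂ lam β γ).bondCurrent N i y| ≤
      (N * ((3 + β) / 2) * (2 * Real.exp ϑ / ϑ ^ 2)) *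
        Real.exp (ϑ * (pinnedChain ω₂ lam β γ).hamiltonian N y) := by
  have hH0 := pinnedChain_hamiltonian_nonneg hω hl hβ γ N y
  have hj := pinnedChain_abs_bondCurrent_le hω hl hβ γ N i y
  have hsq := one_add_sq_le_exp hH0 hϑ
  calc |(pinnedChain ω₂ lam β γ).bondCurrent N i y|
      ≤ N * ((3 + β) / 2 * (1 + (pinnedChain ω₂ lam β γ).hamiltonian N y) ^ 2) := hj
    _ = N * ((3 + β) / 2) * (1 + (pinnedChain ω₂ lam β γ).hamiltonian N y) ^ 2 := by ring
    _ ≤ N * ((3 + β) / 2) * (2 * Real.exp ϑ / ϑ ^ 2 *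
          Real.exp (ϑ * (pinnedChain ω₂ lam β γ).hamiltonian N y)) :=
        mul_le_mul_of_nonneg_left hsq (by positivity)
    _ = (N * ((3 + β) / 2) * (2 * Real.exp ϑ / ϑ ^ 2)) *
          Real.exp (ϑ * (pinnedChain ω₂ lam β γ).hamiltonian N y) := by ring

/-- The exponent `ϑ = 1/(4T)` is admissible: `0 < ϑ` and `2ϑ < 1/T`. [folklore] -/
theorem quarter_inv_temp_admissible {T : ℝ} (hT : 0 < T) : 0 < 1 / (4 * T) ∧ 2 * (1 / (4 * T)) < 1 / T := by
  refine ⟨by positivity, ?_⟩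
  rw [show 2 * (1 / (4 * T)) = 1 / (2 * T) by field_simp; ring, div_lt_div_iff₀ (by positivity) hT]
  nlinarith

/-! ### `C_N(b,·)`: boundedness, measurability, continuity, decay -/

section BondCorr

variable {ω₂ lam β γ : ℝ} (hω : 0 < ω₂) (hl : 0 ≤ lam) (hβ : 0 < β) (hγ : 0 < γ) {N : ℕ} (hN : 0 < N)
  {T : ℝ} (hT : 0 < T)
include hω hl hβ hγ hN hT

/-- **`⟨j_i²⟩_T < ∞`**: the squared bond current is `μ_T`-integrable. [folklore] -/
theorem pinnedChain_integrable_sq_bondCurrent (i : Fin N) :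
    Integrable (fun z => (pinnedChain ω₂ lam β γ).bondCurrent N i z ^ 2) ((pinnedChain ω₂ lam β γ).gibbsMeasure N T) :=
  (pinnedChain_integral_sq_act_le hω hl hβ hγ hN hT (quarter_inv_temp_admissible hT).1
    (quarter_inv_temp_admissible hT).2 (pinnedChain_continuous_bondCurrent ω₂ lam β γ N i)
    (pinnedChain_abs_bondCurrent_le_exp hω.le hl hβ.le γ N (quarter_inv_temp_admissible hT).1 i) 0).1

/-- **`|C_N(i,u)| ≤ ⟨j_i²⟩_T`**: the equilibrium current autocorrelation at ANY bond is bounded by the static second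
moment of the current (Jensen for the Markov kernel + kernel Gibbs invariance). [folklore] -/
theorem pinnedChain_bondCorr_abs_le (i : Fin N) (u : ℝ≥0) :
    |∫ z, (pinnedChain ω₂ lam β γ).bondCurrent N i z *
        (∫ y, (pinnedChain ω₂ lam β γ).bondCurrent N i y ∂((pinnedChain ω₂ lam β γ).transitionKernel N T T u z))
      ∂((pinnedChain ω₂ lam β γ).gibbsMeasure N T)| ≤
      ∫ z, (pinnedChain ω₂ lam β γ).bondCurrent N i z ^ 2 ∂((pinnedChain ω₂ lam β γ).gibbsMeasure N T) :=
  pinnedChain_autocorr_abs_le hω hl hβ hγ hN hT (quarter_inv_temp_admissible hT).1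
    (quarter_inv_temp_admissible hT).2 (pinnedChain_continuous_bondCurrent ω₂ lam β γ N i)
    (pinnedChain_abs_bondCurrent_le_exp hω.le hl hβ.le γ N (quarter_inv_temp_admissible hT).1 i) u

omit hβ hγ hN in
/-- `s ↦ C_N(i,s)` is measurable. [folklore] -/
theorem pinnedChain_measurable_bondCorr (hβ : 0 ≤ β) (hγ : 0 ≤ γ) (i : Fin N) :
    Measurable fun s : ℝ => ∫ z, (pinnedChain ω₂ lam β γ).bondCurrent N i z *
        (∫ y, (pinnedChain ω₂ lam β γ).bondCurrent N i y
          ∂((pinnedChain ω₂ lam β γ).transitionKernel N T T s.toNNReal z))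
      ∂((pinnedChain ω₂ lam β γ).gibbsMeasure N T) :=
  pinnedChain_measurable_autocorr hω hl hT (pinnedChain_continuous_bondCurrent ω₂ lam β γ N i) hβ hγ

/-- **`s ↦ C_N(i,s)` is continuous** on `ℝ` (constant `= C_N(i,0) = ⟨j_i²⟩_T` on `s ≤ 0` by the clamp `s⁺`).
[folklore] -/
theorem pinnedChain_continuous_bondCorr (i : Fin N) :
    Continuous fun s : ℝ => ∫ z, (pinnedChain ω₂ lam β γ).bondCurrent N i z *
        (∫ y, (pinnedChain ω₂ lam β γ).bondCurrent N i y
          ∂((pinnedChain ω₂ lam β γ).transitionKernel N T T s.toNNReal z))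
      ∂((pinnedChain ω₂ lam β γ).gibbsMeasure N T) :=
  pinnedChain_continuous_autocorr hω hl hβ hγ hN hT (quarter_inv_temp_admissible hT).1
    (quarter_inv_temp_admissible hT).2 (pinnedChain_continuous_bondCurrent ω₂ lam β γ N i)
    (pinnedChain_abs_bondCurrent_le_exp hω.le hl hβ.le γ N (quarter_inv_temp_admissible hT).1 i)

/-- **Exponential decay of `C_N(i,·)` at fixed `N`**: `|C_N(i,s)| ≤ C' e^{−cs}` for `s ≥ 0`, with `c = c_N > 0` (no
current at equilibrium, `μ_T(j_i) = 0`, and exponential convergence to `μ_T`).  In particular `C_N(i,·) ∈ L¹(0,∞)`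
and `∫₀^∞ C_N(i,s) ds` is a genuine number at each `N` (physically `T²G_N`, the Kubo–KDN saturation value); the
rate is NOT uniform in `N`. [cite: CuneoEckmannHairerReyBellet2018, Thm 2.13 (3)] -/
theorem pinnedChain_bondCorr_exp_decay (i : Fin N) :
    ∃ C' c : ℝ, 0 < c ∧ ∀ s : ℝ, 0 ≤ s →
      |∫ z, (pinnedChain ω₂ lam β γ).bondCurrent N i z *
          (∫ y, (pinnedChain ω₂ lam β γ).bondCurrent N i y
            ∂((pinnedChain ω₂ lam β γ).transitionKernel N T T s.toNNReal z))
        ∂((pinnedChain ω₂ lam β γ).gibbsMeasure N T)| ≤ C' * Real.exp (-c * s) :=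
  pinnedChain_autocorr_exp_decay hω hl hβ hγ hN hT (quarter_inv_temp_admissible hT).1
    (quarter_inv_temp_admissible hT).2 (pinnedChain_continuous_bondCurrent ω₂ lam β γ N i)
    (pinnedChain_abs_bondCurrent_le_exp hω.le hl hβ.le γ N (quarter_inv_temp_admissible hT).1 i)
    (pinnedChain_integral_bondCurrent_gibbsMeasure ω₂ lam β γ N T i)

/-! ### `V_N(b,·)`: a genuine integral, at most quadratic -/

/-- The integrand `s ↦ (t − s) C_N(i,s)` of `V_N(i,t)` is interval-integrable on every interval. [folklore] -/
theorem pinnedChain_intervalIntegrable_bondHeatVar_integrand (i : Fin N) (t a b : ℝ) :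
    IntervalIntegrable (fun s : ℝ => (t - s) * ∫ z, (pinnedChain ω₂ lam β γ).bondCurrent N i z *
        (∫ y, (pinnedChain ω₂ lam β γ).bondCurrent N i y
          ∂((pinnedChain ω₂ lam β γ).transitionKernel N T T s.toNNReal z))
      ∂((pinnedChain ω₂ lam β γ).gibbsMeasure N T)) volume a b :=
  pinnedChain_intervalIntegrable_heatVar_integrand hω hl hβ hγ hN hT (quarter_inv_temp_admissible hT).1
    (quarter_inv_temp_admissible hT).2 (pinnedChain_continuous_bondCurrent ω₂ lam β γ N i)
    (pinnedChain_abs_bondCurrent_le_exp hω.le hl hβ.le γ N (quarter_inv_temp_admissible hT).1 i) t a b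

/-- **`|V_N(i,t)| ≤ 2⟨j_i²⟩_T t²`** for `t ≥ 0`. [folklore] -/
theorem pinnedChain_abs_bondHeatVar_le_sq (i : Fin N) {t : ℝ} (ht : 0 ≤ t) :
    |2 * ∫ s in (0:ℝ)..t, (t - s) * ∫ z, (pinnedChain ω₂ lam β γ).bondCurrent N i z *
        (∫ y, (pinnedChain ω₂ lam β γ).bondCurrent N i y
          ∂((pinnedChain ω₂ lam β γ).transitionKernel N T T s.toNNReal z))
      ∂((pinnedChain ω₂ lam β γ).gibbsMeasure N T)| ≤
      2 * (∫ z, (pinnedChain ω₂ lam β γ).bondCurrent N i z ^ 2 ∂((pinnedChain ω₂ lam β γ).gibbsMeasure N T)) *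
        t ^ 2 :=
  pinnedChain_abs_heatVar_le_sq hω hl hβ hγ hN hT (quarter_inv_temp_admissible hT).1
    (quarter_inv_temp_admissible hT).2 (pinnedChain_continuous_bondCurrent ω₂ lam β γ N i)
    (pinnedChain_abs_bondCurrent_le_exp hω.le hl hβ.le γ N (quarter_inv_temp_admissible hT).1 i) ht

/-- **`V N b t ≤ 2⟨j_b²⟩_T t²` in the spelling of the route items** (S) `SubdiffusiveBondHeat` / (S_lc)
`LightConeBondHeat` (`C N b s := if h : b < N then ∫ j_b · P_s j_b dμ_T else 0`, `V N b t := 2∫₀ᵗ (t−s) C N b s`),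
for `b < N` and `t ≥ 0`. [folklore] -/
theorem pinnedChain_bondHeatVar_dite_le_sq (b : ℕ) (hb : b < N) {t : ℝ} (ht : 0 ≤ t) :
    2 * ∫ s in (0:ℝ)..t, (t - s) *
        (if h : b < N then
          ∫ z, (pinnedChain ω₂ lam β γ).bondCurrent N ⟨b, h⟩ z *
              (∫ y, (pinnedChain ω₂ lam β γ).bondCurrent N ⟨b, h⟩ y
                ∂((pinnedChain ω₂ lam β γ).transitionKernel N T T s.toNNReal z))
            ∂((pinnedChain ω₂ lam β γ).gibbsMeasure N T)
        else 0) ≤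
      2 * (∫ z, (pinnedChain ω₂ lam β γ).bondCurrent N ⟨b, hb⟩ z ^ 2 ∂((pinnedChain ω₂ lam β γ).gibbsMeasure N T)) *
        t ^ 2 := by
  simp only [dif_pos hb]
  exact (le_abs_self _).trans (pinnedChain_abs_bondHeatVar_le_sq hω hl hβ hγ hN hT ⟨b, hb⟩ ht)

/-- **Bounded windows are free.**  In the items' spelling, for `b < N` and `1 ≤ t ≤ t₀`:
`V N b t ≤ (2⟨j_b²⟩_T · t₀√t₀) · √t` — on any window of `N`-INDEPENDENT length the `A√t` law holds at fixed `N` with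
an explicit constant; the content of (S_lc)/(S) is the growth of the window with `N` (uniformity of `⟨j_b²⟩_T` in
`N` aside). [folklore] -/
theorem pinnedChain_bondHeatVar_le_sqrt_of_le (b : ℕ) (hb : b < N) {t₀ t : ℝ} (h1 : 1 ≤ t) (ht₀ : t ≤ t₀) :
    2 * ∫ s in (0:ℝ)..t, (t - s) *
        (if h : b < N then
          ∫ z, (pinnedChain ω₂ lam β γ).bondCurrent N ⟨b, h⟩ z *
              (∫ y, (pinnedChain ω₂ lam β γ).bondCurrent N ⟨b, h⟩ y
                ∂((pinnedChain ω₂ lam β γ).transitionKernel N T T s.toNNReal z))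
            ∂((pinnedChain ω₂ lam β γ).gibbsMeasure N T)
        else 0) ≤
      (2 * (∫ z, (pinnedChain ω₂ lam β γ).bondCurrent N ⟨b, hb⟩ z ^ 2 ∂((pinnedChain ω₂ lam β γ).gibbsMeasure N T)) *
        (t₀ * Real.sqrt t₀)) * Real.sqrt t := by
  set A : ℝ := ∫ z, (pinnedChain ω₂ lam β γ).bondCurrent N ⟨b, hb⟩ z ^ 2
    ∂((pinnedChain ω₂ lam β γ).gibbsMeasure N T) with hA
  have hA0 : 0 ≤ A := integral_nonneg fun z => sq_nonneg _
  have ht0 : 0 ≤ t := by linarith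
  have ht₀0 : 0 ≤ t₀ := by linarith
  have hV := pinnedChain_bondHeatVar_dite_le_sq hω hl hβ hγ hN hT b hb ht0
  have hst : Real.sqrt t * Real.sqrt t = t := Real.mul_self_sqrt ht0
  have hmono : t * Real.sqrt t ≤ t₀ * Real.sqrt t₀ :=
    mul_le_mul ht₀ (Real.sqrt_le_sqrt ht₀) (Real.sqrt_nonneg _) ht₀0
  have hsq : t ^ 2 = (t * Real.sqrt t) * Real.sqrt t := by rw [mul_assoc, hst, sq]
  calc _ ≤ 2 * A * t ^ 2 := hV
    _ = 2 * A * (t * Real.sqrt t) * Real.sqrt t := by rw [hsq]; ring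
    _ ≤ 2 * A * (t₀ * Real.sqrt t₀) * Real.sqrt t := by
        apply mul_le_mul_of_nonneg_right _ (Real.sqrt_nonneg _)
        exact mul_le_mul_of_nonneg_left hmono (by positivity)
    _ = (2 * A * (t₀ * Real.sqrt t₀)) * Real.sqrt t := by ring

end BondCorr

end Summit.AtomisticToContinuum.FouriersLaw.Theorems.LightConeBondHeat

end
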